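import Mathlib
import Summits.ABC.ABC.Theorems.RibetTakahashiSplitManyPrimeValuationProductJLPackageLemmas
import Summits.ABC.ABC.Theses.RibetTakahashiSplit
import Literature.NumberTheory.Automorphic.ShimuraCurveRibetTakahashi
import Literature.NumberTheory.Automorphic.ShimuraCurveDataExistence
import Literature.NumberTheory.Automorphic.ShimuraCurveRibetTakahashiVolumeProofs
import Literature.NumberTheory.Automorphic.ShimuraCurveDegreeFormulaProofs
import Literature.NumberTheory.Automorphic.ShimuraCurveAnalytic
import Literature.NumberTheory.Automorphic.ShimuraCurveAnalyticProofs
import Literature.NumberTheory.Automorphic.ShimuraCurveMinimalDegreeIsogenyBoundProofs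
import Literature.NumberTheory.EllipticCurves.RationalIsogenyDegrees
import Literature.NumberTheory.EllipticCurves.Isogeny
import Literature.NumberTheory.EllipticCurves.Szpiro
import Literature.NumberTheory.EllipticCurves.IsogenyIdProofs
import Literature.NumberTheory.EllipticCurves.SzpiroOfAbcProofs
import Literature.NumberTheory.DiophantineGeometry.PastenValuationProductsProofs
import Literature.NumberTheory.EllipticCurves.PastenHeightBounds
import Literature.NumberTheory.EllipticCurves.PastenHeightBoundsIsogenyProofs
import Literature.NumberTheory.EllipticCurves.NeronIsogenyScalingHoldsProofs
import Literature.NumberTheory.EllipticCurves.ModularDegreeFormulaProofs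
import Literature.NumberTheory.EllipticCurves.ModularCurveManinConstantProofs
import Literature.NumberTheory.Sieve.DivisorBound
import HarnessLib

/-!
# The Jacquet–Langlands / Ribet–Takahashi / Pasten package in DEGREE form on the whole class,
# semistable away from `2`, from the Mazur–Kenku RADIUS

Helper `--supports` stmt-ABC-1561 (crux
`Summit.ABC.ABC.Theses.RibetTakahashiSplit.ManyPrimeValuationProduct`, line `jl-zero-cycle-height`,
registered stub `stub_jlDegreePackageOfRadius`, skeleton rev c4, stub 8). The stub is the
skeleton's package in DEGREE form `JLDegreePackage` (abbreviations `multPrimes`, `valProd`,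
`discOf`, `IsSemistableAwayFromTwo`, `FermatInput`, `IsCoveringSet` unfolded):
for every `ε > 0` there is `C` such that for every elliptic `W/ℚ` semistable away from `2`
satisfying the Fermat input and every covering set `D` of multiplicative primes there are a global
minimal model `C₀ • W`, a Shimura-curve datum `X` of level `(∏D, N/∏D)` and a parametrisation datum
`P` of `C₀ • W` on `X` with
`log T_D ≤ C + ε log N + log vol(X.fd) − (log P.deg + log covol Λ_P)`.

It is conditional on SIX hypotheses, in the order of the statement: Jacquet–Langlands existence
(`nonempty_shimuraParametrizationData`); H. Pasten, *Shimura curves and the abc conjecture*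
(arXiv:1705.09251 = J. Number Theory 254 (2024)), Thm 6.1 (b) p. 20 in the generality of its proof
(§6.9 p. 25) at `S = {2}` — Thm 6.1 (b′), written out; the optimal quotient `q_{1,N} j_N`
(`exists_optimal_modularParametrizationData`); Pasten Cor 10.2 (`PastenShimura2024_cor_10_2`);
`‖f‖² ≪ N log N` (`murty_petersson_newform_upper_bound`); and the route item
`Summit.ABC.ABC.Theses.RibetTakahashiSplit.MazurKenkuRadius` (two `ℚ`-isogenous elliptic curves
over `ℚ` are joined by a `ℚ`-isogeny of degree `≤ 163`; Mazur 1978 Thm. 1 + Kenku 1982), which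
REPLACES the two Mazur–Kenku-clothed hypotheses of the sibling stub 7 (`stub_jlPackageAwayFromTwo`):
`abs_neronLatticeHeight_sub_le_of_isIsogenous` and `mazurKenku_exists_cyclic_isogeny`. Used AS
THEOREMS of the tree: `nonempty_shimuraCurveData_holds`, `ShimuraCurveData.volume_fd_eq_holds`
(Shimizu), `ShimuraParametrizationData.normSq_form_eq_deg_mul_covolume_holds` (Frey),
`hasGlobalMinimalModel_rat_holds`, `zagier_degree_formula_holds`, and
`integral_neronScaling_of_isGloballyMinimal_holds` with its covolume corollary
`covolume_le_degree_mul_covolume_of_integral_neronScaling` (Faltings' Lemma 5 for `h(E/ℚ)`).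

Proof (Pasten §16, proof of Thm 16.4, over `ℂ`; the sibling's, with the two Mazur–Kenku inputs
re-derived from the radius): take a global minimal model `Wm = C₀ • W` (same conductor `N` and
minimal discriminant); a covering set `D` gives an admissible `N = D' M`
(`admissible_of_isCoveringSet`) with the `≥ 2` multiplicative primes outside `D` dividing `M`
exactly once, so `M` does not have exactly one multiplicative prime; Thm 6.1 (b′) gives
`T_D · a δ_{D,M} = δ_{1,N} b`, `b ≤ κ^{ω(D')}`; for a minimal-degree datum `P'` of `Wm` on `X`:
`P'.deg ≤ 163 δ_{D,M}` (RADIUS: `minimalDegree_le_163_mul_of_radius` below — the tree's reduction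
`deg_le_163_mul_deg_of_isIsogenous` with the Mazur–Kenku list weakened to the radius),
`covol Λ_{Wm} ≤ deg φ · covol Λ_A ≤ 163 covol Λ_A` for the radius isogeny `φ : Wm → A` between
the two global minimal models (Faltings' Lemma 5, covolume form), `4π² c² (f,f) = δ_{1,N} covol Λ_A`
(Zagier), `|c| ≤ 𝓜_{{2}}`, `(f,f) ≤ C N log N ≤ C N^{1+η}/η`; so with `S := P'.deg · covol Λ_{Wm}`
(`= ‖P'.form‖²`, Frey) `T_D ≤ K κ^ω N^{1+η}/S` (`real_chain`); finally
`vol(X.fd) = (π/3)φ(D')ψ(M) ≥ (π/3) N / 2^ω`, `2^ω ≤ d(D') ≤ C_η N^η`, `κ^ω ≤ 2^{κω}` give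
`log T_D ≤ C + (κ+2)η log N + log vol − log S` (`log_chain`) with `η = ε/(κ+2)`, and
`log S = log P'.deg + log covol Λ_{Wm}`.
-/

-- `Summit.ABC.ABC` is the mandated summit-side namespace (CONVENTIONS §2); the duplicate is deliberate.
set_option linter.dupNamespace false

noncomputable section

open MeasureTheory
open scoped MatrixGroups

namespace Summit.ABC.ABC.Theorems.ManyPrimeValuationProduct

open Literature.NumberTheory.Automorphic
open Literature.NumberTheory.EllipticCurves.ModularForms
open CongruenceSubgroup
open Summit.ABC.ABC.Theorems.ManyPrimeValuationProduct.JLPackage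

/-! ### The Shimura-curve corollary of the radius: `P'.deg ≤ 163 · P.deg` -/

open Literature.NumberTheory.EllipticCurves Literature.NumberTheory.EllipticCurves.ModularForms
  _root_.WeierstrassCurve in
/-- **The minimal parametrisation degree of an isogenous curve is at most `163 · deg`, from the
Mazur–Kenku RADIUS.** Pasten §16 p. 49: *"Since `A_{1,N}` and `A_{D,M}` are both isogenous to
`E`, they are connected by an isogeny of degree `≤ 163`"*; proof of Lemma 6.8, p. 22. This is the
tree's `ShimuraParametrizationData.deg_le_163_mul_deg_of_isIsogenous` with its hypothesis — the
Mazur–Kenku LIST `mazurKenku_exists_cyclic_isogeny` — weakened to the radius statement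
`MazurKenkuRadius` (two `ℚ`-isogenous elliptic curves over `ℚ` are joined by a `ℚ`-isogeny of
degree `≤ 163`), which is all the reduction consumes: for ANY datum `P` of `W` on `X₀^D(M)`, any
elliptic `W'` `ℚ`-isogenous to `W`, and `P'` of minimal degree among the data of `W'` on the same
curve, `P'.deg ≤ 163 · P.deg`. Proof: pass to the short models `C • W ⊗ ℂ = E_Λ`,
`C' • W' ⊗ ℂ = E_{Λ'}` (`Λ = Λ_{P.L}`, `Λ'` any Néron lattice of `W'`), take a `ℚ`-isogeny
`ψ : C • W → C' • W'` of degree `≤ 163` (radius), read it analytically as `z ↦ qz`, `qΛ ⊆ Λ'`,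
`deg ψ = #ker(z ↦ qz : ℂ/Λ → ℂ/Λ')` (`degree_eq_natCard_ker_mulQuotientMap_of_baseChange_eq_curve`),
and compose: `exists_deg_eq_natCard_ker_mul` gives a datum of `W'` of degree `deg ψ · P.deg` (the
Hecke line is unchanged as `L(W, s) = L(W', s)`), whence `P'.deg ≤ deg ψ · P.deg ≤ 163 · P.deg`.
`[folklore]` -/
theorem ShimuraParametrizationData.deg_le_163_mul_deg_of_radius
    (hR : Summit.ABC.ABC.Theses.RibetTakahashiSplit.MazurKenkuRadius) {D M : ℕ}
    {X : ShimuraCurveData D M} {W W' : WeierstrassCurve ℚ} [W.IsElliptic] [W'.IsElliptic]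
    (P : ShimuraParametrizationData X W) (P' : ShimuraParametrizationData X W')
    (hWW' : W'.IsIsogenous W) (hP' : ∀ P'' : ShimuraParametrizationData X W', P'.deg ≤ P''.deg) :
    P'.deg ≤ 163 * P.deg := by
  have hiso : IsIsogenous W W' := hWW'.symm_of_charZero
  haveI : (W'.baseChange ℂ).IsElliptic := by
    rw [WeierstrassCurve.baseChange]; infer_instance
  -- a Néron lattice of `W'`
  obtain ⟨L', hL'⟩ := exists_isNeronLatticeOf_holds (W'.baseChange ℂ)
  -- the short models are `E_Λ`, `E_{Λ'}` after base change, and are `ℚ`-isogenous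
  set C : VariableChange ℚ := ⟨1, -W.b₂ / 12, -W.a₁ / 2, W.a₁ * W.b₂ / 24 - W.a₃ / 2⟩ with hC
  set C' : VariableChange ℚ := ⟨1, -W'.b₂ / 12, -W'.a₁ / 2, W'.a₁ * W'.b₂ / 24 - W'.a₃ / 2⟩
    with hC'
  have hE : (C • W).baseChange ℂ = P.L.curve := shortModel_baseChange_eq_curve W P.isNeronLattice
  have hE' : (C' • W').baseChange ℂ = L'.curve := shortModel_baseChange_eq_curve W' hL'
  have h : IsIsogenous (C • W) (C' • W') :=
    (isIsogenous_of_smul W C).trans' (hiso.trans' (isIsogenous_smul W' C'))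
  -- RADIUS: a `ℚ`-isogeny `ψ` of degree `≤ 163`
  obtain ⟨ψ, h163⟩ := hR (C • W) (C' • W') h
  -- its rational multiplier `q`: `qΛ ⊆ Λ'`, `#ker(z ↦ qz) = deg ψ`
  obtain ⟨q, hq0, hq, hdegq⟩ :=
    degree_eq_natCard_ker_mulQuotientMap_of_baseChange_eq_curve ψ hE hE'
  -- the composite datum of `W'`, of degree `deg ψ · P.deg`
  have hq0' : (q : ℂ) ≠ 0 := by exact_mod_cast hq0
  obtain ⟨P₁, hP₁⟩ := P.exists_deg_eq_natCard_ker_mul hiso.LFunction_eq hL' hq0' hq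
  calc P'.deg ≤ P₁.deg := hP' P₁
    _ = ψ.degree * P.deg := by rw [hP₁, hdegq]
    _ ≤ 163 * P.deg := Nat.mul_le_mul_right _ h163

/-- **`P'.deg ≤ 163 · δ_{D,M}` from the radius, in the `IsMinimalFor` shape** (the tree's
`minimalDegree_le_163_mul_of_mazurKenku` with the Mazur–Kenku list weakened to `MazurKenkuRadius`;
only the isogeny clause of `P.IsMinimalFor W'` is used). `[folklore]` -/
theorem ShimuraParametrizationData.minimalDegree_le_163_mul_of_radius
    (hR : Summit.ABC.ABC.Theses.RibetTakahashiSplit.MazurKenkuRadius) {D M : ℕ}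
    {X : ShimuraCurveData D M} {W W' : WeierstrassCurve ℚ} [W.IsElliptic] [W'.IsElliptic]
    (P : ShimuraParametrizationData X W) (P' : ShimuraParametrizationData X W')
    (hmin : P.IsMinimalFor W') (hP' : ∀ P'' : ShimuraParametrizationData X W', P'.deg ≤ P''.deg) :
    P'.deg ≤ 163 * P.deg :=
  ShimuraParametrizationData.deg_le_163_mul_deg_of_radius hR P P' hmin.1 hP'

/-! ### The stub -/

/-- **`JLDegreePackage` on the whole class from Thm 6.1 (b′), four cited theorems and the
Mazur–Kenku radius** (registered stub `stub_jlDegreePackageOfRadius` of line `jl-zero-cycle-height`,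
rev c4; the skeleton's `JLDegreePackage` with abbreviations unfolded, preceded by its six
hypotheses). The witnesses are: `C₀` = a change of variables to a global minimal model, `X` = any
datum of level `(∏D, N/∏D)`, `P` = a minimal-degree Jacquet–Langlands parametrisation of the
minimal model on `X` (Pasten arXiv:1705.09251 §16, proof of Thm 16.4, with Thm 6.1 (b′) in place
of Thm 6.1 (b) and the radius in place of Mazur–Kenku; module docstring for the chain).
`[folklore]` -/
theorem stub_jlDegreePackageOfRadius :
    Literature.NumberTheory.Automorphic.nonempty_shimuraParametrizationData →
    (∃ κ : ℕ, 1 ≤ κ ∧ (∀ q ∈ κ.primeFactors, q ≤ 163) ∧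
      ∀ {N D M : ℕ} [NeZero N], Literature.NumberTheory.Automorphic.IsAdmissibleFactorization N D M →
      ∀ (X : Literature.NumberTheory.Automorphic.ShimuraCurveData D M) (W : WeierstrassCurve ℚ)
        [W.IsElliptic] [W.IsGloballyMinimal],
        W.conductorNorm ℤ = N → (∀ q : ℕ, q.Prime → q ∉ ({2} : Finset ℕ) → ¬ q ^ 2 ∣ N) →
        (∀ ℓ : ℕ, ℓ.Prime → 11 ≤ ℓ → ∃ r : ℕ, r.Prime ∧ r ∣ N ∧ ¬ r ^ 2 ∣ N ∧
          ¬ ℓ ∣ (W.minimalDiscriminantNorm ℤ).factorization r) →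
        (M.primeFactors.filter fun t => ¬ t ^ 2 ∣ N).card ≠ 1 →
      ∀ (W₁ : WeierstrassCurve ℚ) [W₁.IsElliptic]
        (D₁ : Literature.NumberTheory.EllipticCurves.ModularForms.ModularParametrizationData W₁ N),
        Literature.NumberTheory.EllipticCurves.ModularForms.IsNewformOf W D₁.f →
        (∀ (W₂ : WeierstrassCurve ℚ) [W₂.IsElliptic]
            (D₂ : Literature.NumberTheory.EllipticCurves.ModularForms.ModularParametrizationData W₂ N),
            D₂.f = D₁.f → D₁.modularDegree ≤ D₂.modularDegree) →
      ∀ (W' : WeierstrassCurve ℚ) [W'.IsElliptic]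
        (P : Literature.NumberTheory.Automorphic.ShimuraParametrizationData X W'),
        P.IsMinimalFor W →
          ∃ a b : ℕ, 0 < a ∧ 0 < b ∧ b ∣ κ ^ D.primeFactors.card ∧
            D₁.modularDegree * b =
              a * P.deg * ∏ p ∈ D.primeFactors, (W.minimalDiscriminantNorm ℤ).factorization p) →
    Literature.NumberTheory.Automorphic.exists_optimal_modularParametrizationData →
    Literature.NumberTheory.Automorphic.PastenShimura2024_cor_10_2 →
    Literature.NumberTheory.Automorphic.murty_petersson_newform_upper_bound →
    Summit.ABC.ABC.Theses.RibetTakahashiSplit.MazurKenkuRadius →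
    ∀ ε : ℝ, 0 < ε → ∃ C : ℝ, ∀ (W : WeierstrassCurve ℚ) [W.IsElliptic],
      (∀ p : ℕ, p.Prime → p ≠ 2 → ¬ p ^ 2 ∣ W.conductorNorm ℤ) →
      (∀ ℓ : ℕ, ℓ.Prime → 11 ≤ ℓ →
        ∃ r ∈ (W.conductorNorm ℤ).primeFactors.filter (fun p => ¬ p ^ 2 ∣ W.conductorNorm ℤ),
          ¬ ℓ ∣ (W.minimalDiscriminantNorm ℤ).factorization r) →
      ∀ D : Finset ℕ,
        (D ⊆ (W.conductorNorm ℤ).primeFactors.filter (fun p => ¬ p ^ 2 ∣ W.conductorNorm ℤ) ∧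
          Even D.card ∧ 2 ≤ D.card ∧
          2 ≤ ((W.conductorNorm ℤ).primeFactors.filter (fun p => ¬ p ^ 2 ∣ W.conductorNorm ℤ) \
            D).card) →
        ∃ C₀ : WeierstrassCurve.VariableChange ℚ, (C₀ • W).IsGloballyMinimal ∧
          ∃ (X : Literature.NumberTheory.Automorphic.ShimuraCurveData (∏ p ∈ D, p)
              (W.conductorNorm ℤ / ∏ p ∈ D, p))
            (P : Literature.NumberTheory.Automorphic.ShimuraParametrizationData X (C₀ • W)),
            Real.log ((∏ p ∈ D, (W.minimalDiscriminantNorm ℤ).factorization p : ℕ) : ℝ) ≤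
              C + ε * Real.log (W.conductorNorm ℤ) +
                Real.log (MeasureTheory.volume X.fd).toReal -
                  (Real.log (P.deg : ℝ) + Real.log (ZLattice.covolume P.L.lattice)) := by
  intro hJL h61 hopt hManin hPet hR ε hε
  -- three inputs of Pasten §16, as theorems of the tree
  have hXex : Literature.NumberTheory.Automorphic.nonempty_shimuraCurveData :=
    Literature.NumberTheory.Automorphic.nonempty_shimuraCurveData_holds
  have hvol : Literature.NumberTheory.Automorphic.ShimuraCurveData.volume_fd_eq :=
    Literature.NumberTheory.Automorphic.ShimuraCurveData.volume_fd_eq_holds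
  have hFrey :
      Literature.NumberTheory.Automorphic.ShimuraParametrizationData.normSq_form_eq_deg_mul_covolume :=
    Literature.NumberTheory.Automorphic.ShimuraParametrizationData.normSq_form_eq_deg_mul_covolume_holds
  -- constants, chosen before the curve
  obtain ⟨κ, hκ1, -, h61⟩ := h61
  obtain ⟨𝓜, hManin⟩ := hManin {2}
  obtain ⟨Cpet, hPet⟩ := hPet
  set Cp : ℝ := max Cpet 1 with hCpdef
  set 𝓜' : ℝ := max (𝓜 : ℝ) 1 with h𝓜'def
  set η : ℝ := ε / (κ + 2) with hηdef
  have hη : 0 < η := by positivity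
  obtain ⟨Cη, hCη1, hCη⟩ := Literature.NumberTheory.Sieve.exists_card_divisors_le_mul_rpow' hη
  set K : ℝ := 4 * Real.pi ^ 2 * 𝓜' ^ 2 * Cp * 163 ^ 2 / η with hKdef
  have hCp1 : 1 ≤ Cp := le_max_right _ _
  have h𝓜'1 : 1 ≤ 𝓜' := le_max_right _ _
  have hK : 0 < K := by positivity
  refine ⟨Real.log K + (κ + 1) * Real.log Cη + Real.log (3 / Real.pi), ?_⟩
  intro W _ hss hFI D hcov
  -- a globally minimal model
  obtain ⟨C₀, hC₀⟩ := WeierstrassCurve.hasGlobalMinimalModel_rat_holds W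
  haveI := hC₀
  set Wm := C₀ • W with hWm
  have hNeq : Wm.conductorNorm ℤ = W.conductorNorm ℤ := WeierstrassCurve.conductorNorm_smul_rat W C₀
  have hΔeq : Wm.minimalDiscriminantNorm ℤ = W.minimalDiscriminantNorm ℤ :=
    WeierstrassCurve.minimalDiscriminantNorm_smul_rat W C₀
  set N := W.conductorNorm ℤ with hNdef
  have hNpos : 0 < N := W.conductorNorm_pos_holds
  haveI : NeZero N := ⟨hNpos.ne'⟩
  obtain ⟨hDsub, heven, h2D, h2M⟩ := hcov
  obtain ⟨hadm, hMsub⟩ := admissible_of_isCoveringSet hDsub heven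
  have hprime : ∀ p ∈ D, p.Prime := fun p hp => prime_of_mem hDsub hp
  set D' := ∏ p ∈ D, p with hD'def
  set M := N / D' with hMdef
  set T : ℕ := ∏ p ∈ D, (W.minimalDiscriminantNorm ℤ).factorization p with hTdef
  have hMpos : 0 < M := hadm.pos_right
  have hD'M : D' * M = N := hadm.mul_eq
  have hωD : D'.primeFactors = D := primeFactors_prod_primes hprime
  -- the data
  obtain ⟨X⟩ := hXex hadm
  obtain ⟨PW⟩ := hJL hadm X Wm hNeq
  obtain ⟨P', hP'min⟩ := exists_self_minimal PW
  obtain ⟨W₀', hW₀', P₀, hP₀⟩ := exists_class_minimal PW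
  obtain ⟨W₀, hW₀e, hW₀m, D₀, hnew, hiso, hD₀min⟩ := hopt N Wm hNeq
  -- the three hypotheses of Thm 6.1 (b′): semistable away from `2`, the Fermat input for `Wm`,
  -- and `M` does not have exactly one multiplicative prime
  have hS2 : ∀ q : ℕ, q.Prime → q ∉ ({2} : Finset ℕ) → ¬ q ^ 2 ∣ N :=
    fun q hq hq2 => hss q hq (by simpa using hq2)
  have hFI' : ∀ ℓ : ℕ, ℓ.Prime → 11 ≤ ℓ → ∃ r : ℕ, r.Prime ∧ r ∣ N ∧ ¬ r ^ 2 ∣ N ∧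
      ¬ ℓ ∣ (Wm.minimalDiscriminantNorm ℤ).factorization r := by
    intro ℓ hℓ h11
    obtain ⟨r, hr, hℓr⟩ := hFI ℓ hℓ h11
    obtain ⟨hr1, hr2⟩ := Finset.mem_filter.mp hr
    refine ⟨r, Nat.prime_of_mem_primeFactors hr1, Nat.dvd_of_mem_primeFactors hr1, hr2, ?_⟩
    rwa [hΔeq]
  have hM1 : (M.primeFactors.filter fun t => ¬ t ^ 2 ∣ N).card ≠ 1 := by
    have hsub : (N.primeFactors.filter fun p => ¬ p ^ 2 ∣ N) \ D ⊆
        M.primeFactors.filter fun t => ¬ t ^ 2 ∣ N := by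
      intro q hq
      rw [Finset.mem_filter]
      exact ⟨hMsub hq, (Finset.mem_filter.mp (Finset.mem_sdiff.mp hq).1).2⟩
    have h2 := h2M.trans (Finset.card_le_card hsub)
    omega
  -- Thm 6.1 (b′)
  obtain ⟨a, b, ha, hb, hbκ, hEq⟩ :=
    h61 hadm X Wm hNeq hS2 hFI' hM1 W₀ D₀ hnew hD₀min W₀' P₀ hP₀
  rw [hωD] at hbκ
  rw [hωD, hΔeq] at hEq
  -- hEq : δ₁ * b = a * δ * T
  have hδ₁pos : 0 < D₀.modularDegree := D₀.deg_pos
  have hT1 : 1 ≤ T := by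
    rcases Nat.eq_zero_or_pos T with h0 | h0
    · rw [← hTdef, h0, mul_zero] at hEq
      exact absurd hEq (Nat.mul_ne_zero hδ₁pos.ne' hb.ne')
    · exact h0
  have hbκ' : b ≤ κ ^ D.card := Nat.le_of_dvd (pow_pos hκ1 _) hbκ
  -- radius (Shimura-curve corollary), Frey, Zagier, Manin, Petersson
  have hdeg : P'.deg ≤ 163 * P₀.deg :=
    ShimuraParametrizationData.minimalDegree_le_163_mul_of_radius hR P₀ P' hP₀ hP'min
  have hnorm : X.normSq P'.form = P'.deg * ZLattice.covolume P'.L.lattice := hFrey P'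
  have hz := D₀.zagier_degree_formula_holds
  have hff0 : 0 < (peterssonProduct (Gamma0 N) 2 D₀.f D₀.f).re := hz.peterssonProduct_re_pos
  have hzr : 4 * Real.pi ^ 2 * (D₀.c : ℝ) ^ 2 * (peterssonProduct (Gamma0 N) 2 D₀.f D₀.f).re =
      D₀.deg * ZLattice.covolume D₀.L.lattice := by
    have := congrArg Complex.re hz
    rwa [Complex.re_ofReal_mul, Complex.ofReal_re] at this
  have hc : |D₀.maninConstant| ≤ (𝓜 : ℤ) := hManin N W₀ D₀ hS2 hD₀min
  have hc' : |(D₀.c : ℝ)| ≤ 𝓜' := by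
    have h1 : ((|D₀.c| : ℤ) : ℝ) ≤ (𝓜 : ℝ) := by exact_mod_cast hc
    rw [Int.cast_abs] at h1
    rw [h𝓜'def]
    exact h1.trans (le_max_left _ _)
  have hpet : (peterssonProduct (Gamma0 N) 2 D₀.f D₀.f).re ≤ Cpet * N * Real.log N :=
    hPet N W₀ D₀.f D₀.isNewformOf
  -- positivity of the covolumes and the comparison `V ≤ 163 V₀` (radius + Faltings' Lemma 5 in
  -- covolume form, from the integrality of Néron scalings between the global minimal models)
  have hV : 0 < ZLattice.covolume P'.L.lattice := ZLattice.covolume_pos _ _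
  have hV₀ : 0 < ZLattice.covolume D₀.L.lattice := ZLattice.covolume_pos _ _
  have hVV : ZLattice.covolume P'.L.lattice ≤ 163 * ZLattice.covolume D₀.L.lattice := by
    obtain ⟨φ, hφ⟩ := hR Wm W₀ hiso
    have h := covolume_le_degree_mul_covolume_of_integral_neronScaling
      Literature.NumberTheory.EllipticCurves.integral_neronScaling_of_isGloballyMinimal_holds Wm W₀
      P'.isNeronLattice D₀.isNeronLattice φ
    have hφ' : (φ.degree : ℝ) ≤ 163 := by exact_mod_cast hφ
    exact h.trans (mul_le_mul_of_nonneg_right hφ' hV₀.le)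
  -- the Petersson bound in power form: `N log N ≤ N^{1+η}/η`
  have hN1 : (1 : ℝ) ≤ N := by exact_mod_cast hNpos
  have hpet' : (peterssonProduct (Gamma0 N) 2 D₀.f D₀.f).re ≤ Cp * ((N : ℝ) ^ (1 + η) / η) := by
    have hlogN : 0 ≤ Real.log N := Real.log_nonneg hN1
    have h1 : Cpet * N * Real.log N ≤ Cp * N * Real.log N := by
      have : 0 ≤ (N : ℝ) * Real.log N := by positivity
      nlinarith [le_max_left Cpet 1]
    have h2 : Real.log N ≤ (N : ℝ) ^ η / η := Real.log_le_rpow_div (by positivity) hη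
    have h3 : (N : ℝ) * ((N : ℝ) ^ η / η) = (N : ℝ) ^ (1 + η) / η := by
      rw [Real.rpow_add (by positivity), Real.rpow_one, mul_div_assoc]
    calc (peterssonProduct (Gamma0 N) 2 D₀.f D₀.f).re ≤ Cp * N * Real.log N := hpet.trans h1
      _ ≤ Cp * N * ((N : ℝ) ^ η / η) := by
          apply mul_le_mul_of_nonneg_left h2; positivity
      _ = Cp * ((N : ℝ) ^ (1 + η) / η) := by rw [mul_assoc, h3]
  -- the multiplicative chain
  set S : ℝ := X.normSq P'.form
  have hTeq : (T : ℝ) * (a * P₀.deg) = D₀.modularDegree * b := by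
    have : ((D₀.modularDegree * b : ℕ) : ℝ) = ((a * P₀.deg * T : ℕ) : ℝ) := by
      exact_mod_cast hEq
    push_cast at this
    linarith
  have hchain := real_chain (κω := (κ : ℝ) ^ D.card) hTeq (by exact_mod_cast ha) (by positivity)
    (by exact_mod_cast hbκ') (by exact_mod_cast P₀.deg_pos) (by positivity) (by positivity)
    (by exact_mod_cast hdeg) (by exact_mod_cast P'.deg_pos) hnorm hV hV₀ hVV hzr hc' hff0.le hpet'
  have hchain' : (T : ℝ) ≤ K * (κ : ℝ) ^ D.card * (N : ℝ) ^ (1 + η) / S := by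
    rw [hKdef]
    convert hchain using 1
    field_simp
  -- positivity of `S`
  have hdegR : (0 : ℝ) < P'.deg := by exact_mod_cast P'.deg_pos
  have hS : 0 < S := by rw [hnorm]; exact mul_pos hdegR hV
  -- the volume
  have hv := hvol X hMpos
  set vol : ℝ := (volume X.fd).toReal with hvoldef
  have hφψ : (D' * M : ℝ) ≤ (Nat.totient D' * gamma0Index M : ℕ) * (2 : ℝ) ^ D.card := by
    have h1 : D' ≤ Nat.totient D' * 2 ^ D.card := prod_le_totient_mul_two_pow hprime
    have h2 : M ≤ gamma0Index M := le_gamma0Index M hMpos.ne'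
    have : D' * M ≤ Nat.totient D' * gamma0Index M * 2 ^ D.card := by
      calc D' * M ≤ (Nat.totient D' * 2 ^ D.card) * gamma0Index M := Nat.mul_le_mul h1 h2
        _ = Nat.totient D' * gamma0Index M * 2 ^ D.card := by ring
    exact_mod_cast this
  have hvoleq : vol = Real.pi / 3 * ((Nat.totient D' * gamma0Index M : ℕ) : ℝ) := by
    rw [hvoldef, hv, ENNReal.toReal_ofReal (by positivity)]
  have hvol0 : 0 < vol := by
    rw [hvoleq]
    have : 0 < Nat.totient D' * gamma0Index M :=
      Nat.mul_pos (Nat.totient_pos.mpr hadm.pos_left) (hMpos.trans_le (le_gamma0Index M hMpos.ne'))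
    positivity
  have hvolb : Real.pi / 3 * (N : ℝ) ≤ vol * (2 : ℝ) ^ D.card := by
    rw [hvoleq, ← hD'M]
    push_cast
    have hπ : 0 ≤ Real.pi / 3 := by positivity
    calc Real.pi / 3 * ((D' : ℝ) * M)
        ≤ Real.pi / 3 * ((Nat.totient D' * gamma0Index M : ℕ) * (2 : ℝ) ^ D.card) :=
          mul_le_mul_of_nonneg_left hφψ hπ
      _ = _ := by push_cast; ring
  -- the divisor bound `2^ω ≤ C_η N^η`
  have hdiv : (2 : ℝ) ^ D.card ≤ Cη * (N : ℝ) ^ η := by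
    have h1 : ((2 ^ D.card : ℕ) : ℝ) ≤ (D'.divisors.card : ℝ) := by
      exact_mod_cast two_pow_card_le_card_divisors hprime
    have h2 := hCη D'
    have h3 : (D' : ℝ) ^ η ≤ (N : ℝ) ^ η := by
      apply Real.rpow_le_rpow (by positivity) _ hη.le
      exact_mod_cast Nat.le_of_dvd hNpos (hD'M ▸ dvd_mul_right D' M)
    push_cast at h1
    calc (2 : ℝ) ^ D.card ≤ D'.divisors.card := h1
      _ ≤ Cη * (D' : ℝ) ^ η := h2
      _ ≤ Cη * (N : ℝ) ^ η := mul_le_mul_of_nonneg_left h3 (by linarith)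
  -- the logarithmic chain
  have hκR : (1 : ℝ) ≤ κ := by exact_mod_cast hκ1
  have hκ2 : (κ : ℝ) ≤ 2 ^ (κ : ℝ) := by
    rw [Real.rpow_natCast]; exact_mod_cast (Nat.lt_two_pow_self (n := κ)).le
  have hlogT := log_chain (ω := D.card) (by exact_mod_cast hT1) hchain' hK hS hκR hκ2 hN1
    hCη1 rfl hdiv hvol0 hvolb
  have hεη : ((κ : ℝ) + 2) * η = ε := by rw [hηdef]; field_simp
  rw [hεη] at hlogT
  -- `log S = log P'.deg + log covol Λ_{P'}` (`hnorm : S = P'.deg * covol`, Frey's identity)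
  have hlogS : Real.log S = Real.log (P'.deg : ℝ) + Real.log (ZLattice.covolume P'.L.lattice) := by
    rw [hnorm, Real.log_mul hdegR.ne' hV.ne']
  refine ⟨C₀, hC₀, X, P', ?_⟩
  rw [← hlogS]
  exact hlogT

end Summit.ABC.ABC.Theorems.ManyPrimeValuationProduct

end
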